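import Mathlib
import HarnessLib
import Literature.Analysis.FluidPDE.SuitableWeak
import Literature.Analysis.FluidPDE.SelfSimilar
import Literature.Analysis.FluidPDE.LocalTypeI
import Literature.Analysis.FluidPDE.SlabTypeICompactness
import Literature.Analysis.FluidPDE.LocalTypeICongr
import Summits.NavierStokesRegularity.NavierStokesRegularity.Theorems.RellichScarNoMildScarZoom

/-!
# No mild scar under Type I (route RellichScar, item `NoMildScar`): the blow-up limit at the apex

Helper file for the proof of `Summit.NavierStokesRegularity.NavierStokesRegularity.Theses.RellichScar.NoMildScar`
(stmt-NavierStokesRegularity-11723).  For an apex Type-I profile `u` — a suitable weak solution of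
Navier–Stokes (`ν = 1`, `f = 0`) on the backward slab `(-∞, 0) × ℝ³` with a weak gradient,
Albritton–Barker quantity `𝐈 < ∞`, the apex bound `‖u(t, x)‖ ≤ C/(‖x‖ + √(−t))` and a
backward-singular origin — the zooms `u_c(s, y) = c u(c² s, c y)` at the scales `c = 2^{-(k+1)}`
are again such profiles with the same `𝐈` and `C` (`RellichScarNoMildScarZoom`).  The tree's ENGINE
`Literature.Analysis.FluidPDE.slab_typeI_compactness` (Albritton–Barker 2019, Lemma 2.2 + Prop. 2.3
+ lower semicontinuity of `A, C, D, E`, on the whole slab) extracts a subsequence converging in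
`L³(Q(0, R))` for every `R > 0` to a suitable weak solution `(w, π)` on the slab with a weak gradient
`H`, `𝐈(w, π, H) ≤ 4 𝐈(u) < ∞`, backward-singular at the origin (every zoom is singular there,
`zoom_isBackwardSingularPoint`, so the `L^∞` norms blow up trivially), and the apex bound passes to
the limit almost everywhere (a.e. convergence along a further subsequence on each `Q(0, n + 1)`).

* `exists_blowup_limit_apex` — the statement just described.

Reference: D. Albritton, T. Barker, *On local Type I singularities of the Navier–Stokes equations
and Liouville theorems*, J. Math. Fluid Mech. 21 (2019) = arXiv:1811.00502, §3.
-/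

noncomputable section

-- the summit and its single sub-problem share the name (CONVENTIONS §1), as in every Theorems file
set_option linter.dupNamespace false

namespace Summit.NavierStokesRegularity.NavierStokesRegularity.Theorems.RellichScarNoMildScar

open MeasureTheory Set Function Metric Filter Topology TopologicalSpace
open scoped ENNReal NNReal
open Literature.Analysis Literature.Analysis.FluidPDE
open Summit.NavierStokesRegularity.NavierStokesRegularity.Theorems.RellichScarApexLocalisation

local notation "E³" => EuclideanSpace ℝ (Fin 3)

variable {u : ℝ → E³ → E³} {p : ℝ → E³ → ℝ} {G : ℝ → E³ → E³ →L[ℝ] E³}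

/-- The dyadic scales `2^{-(n+1)}` are in `(0, 1/2]` and tend to zero. [folklore] -/
theorem dyadicScale_facts :
    (∀ n : ℕ, (0 : ℝ) < (1 / 2 : ℝ) ^ (n + 1)) ∧ (∀ n : ℕ, (1 / 2 : ℝ) ^ (n + 1) ≤ 1 / 2) ∧
      Tendsto (fun n : ℕ => (1 / 2 : ℝ) ^ (n + 1)) atTop (𝓝 0) := by
  refine ⟨fun n => by positivity, fun n => ?_, ?_⟩
  · calc (1 / 2 : ℝ) ^ (n + 1) ≤ (1 / 2 : ℝ) ^ 1 :=
        pow_le_pow_of_le_one (by norm_num) (by norm_num) (by omega)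
      _ = 1 / 2 := pow_one _
  · exact (tendsto_pow_atTop_nhds_zero_of_lt_one (by norm_num) (by norm_num)).comp
      (tendsto_add_atTop_nat 1)

/-- **The blow-up limit at the apex of a singular apex Type-I profile.**  Let `(u, p)` be a
suitable weak solution on the backward slab with weak gradient `G`, `𝐈 < ∞`, the pointwise apex
bound `‖u(t, x)‖ ≤ C/(‖x‖ + √(−t))` and a backward-singular origin.  Then along some scales
`c_j ↓ 0`, `0 < c_j ≤ 1/2`, the zooms `u_{c_j}(s, y) = c_j u(c_j² s, c_j y)` converge in
`L³(Q(0, R))` for every `R > 0` to a suitable weak solution `(w, π)` on the slab with a weak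
gradient `H`, `𝐈(w, π, H) < ∞`, a backward-singular origin, and the apex bound almost
everywhere on the slab (Albritton–Barker 2019, §3, through the tree's
`slab_typeI_compactness`). [cite: AlbrittonBarker2019, Lemma 2.2, Prop. 2.3 and §3] -/
theorem exists_blowup_limit_apex
    (hsw : IsSuitableWeakSolutionOn (slab E³ (Iio 0) isOpen_Iio) 1 0 u p)
    (hwg : HasWeakSpatialGradientOn (slab E³ (Iio 0) isOpen_Iio) u G)
    (hI : typeIBound (Iio (0 : ℝ) ×ˢ univ) u p G < ⊤) {C : ℝ} (hdec : HasTypeIDecay C u)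
    (hsing : IsBackwardSingularPoint u 0) :
    ∃ (w : ℝ → E³ → E³) (π : ℝ → E³ → ℝ) (H : ℝ → E³ → E³ →L[ℝ] E³) (c : ℕ → ℝ),
      (∀ j, 0 < c j) ∧ (∀ j, c j ≤ 1 / 2) ∧ Tendsto c atTop (𝓝 0) ∧
      IsSuitableWeakSolutionOn (slab E³ (Iio 0) isOpen_Iio) 1 0 w π ∧
      HasWeakSpatialGradientOn (slab E³ (Iio 0) isOpen_Iio) w H ∧
      typeIBound (Iio (0 : ℝ) ×ˢ univ) w π H < ⊤ ∧
      (∀ R : ℝ, 0 < R → Tendsto (fun j => eLpNorm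
        (uncurry (c j • stPull (c j ^ 2) (c j) 0 (0 : E³) u) - uncurry w) 3
        (volume.restrict (parabolicCylinder R (0 : ℝ × E³)))) atTop (𝓝 0)) ∧
      IsBackwardSingularPoint w 0 ∧
      (∀ᵐ z ∂(volume.restrict (Iio (0 : ℝ) ×ˢ (univ : Set E³))),
        ‖w z.1 z.2‖ ≤ C / (‖z.2‖ + Real.sqrt (-z.1))) := by
  obtain ⟨hlpos, hlhalf, hl0⟩ := dyadicScale_facts
  set lam : ℕ → ℝ := fun n => (1 / 2 : ℝ) ^ (n + 1) with hlam
  set I : ℝ≥0∞ := typeIBound (Iio (0 : ℝ) ×ˢ (univ : Set E³)) u p G with hIdef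
  -- ## the zoomed family
  set v : ℕ → ℝ → E³ → E³ := fun k => lam k • stPull (lam k ^ 2) (lam k) 0 (0 : E³) u with hv
  set qk : ℕ → ℝ → E³ → ℝ := fun k => lam k ^ 2 • stPull (lam k ^ 2) (lam k) 0 (0 : E³) p with hqk
  set Gk : ℕ → ℝ → E³ → E³ →L[ℝ] E³ :=
    fun k => lam k ^ 2 • stPull (lam k ^ 2) (lam k) 0 (0 : E³) G with hGk
  have hswk : ∀ k, IsSuitableWeakSolutionOn (slab E³ (Iio 0) isOpen_Iio) 1 0 (v k) (qk k) :=
    fun k => zoom_isSuitableWeakSolutionOn_slab hsw (hlpos k)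
  have hwgk : ∀ k, HasWeakSpatialGradientOn (slab E³ (Iio 0) isOpen_Iio) (v k) (Gk k) :=
    fun k => zoom_hasWeakSpatialGradientOn_slab hwg (hlpos k)
  have hbdk : ∀ k, typeIBound (Iio (0 : ℝ) ×ˢ univ) (v k) (qk k) (Gk k) ≤ I := fun k =>
    (typeIBound_lowerHalf_nsZoom (hlpos k) u p G).le
  have hsingk : ∀ k, IsBackwardSingularPoint (v k) 0 := fun k =>
    zoom_isBackwardSingularPoint hsing (hlpos k)
  have hapexk : ∀ k (z : ℝ × E³), z.1 < 0 → ‖v k z.1 z.2‖ ≤ C / (‖z.2‖ + Real.sqrt (-z.1)) :=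
    fun k z hz => zoom_hasTypeIDecay hdec (hlpos k) z.1 hz z.2
  -- ## the ENGINE
  obtain ⟨w, π, H, σ, hσ, hsww, hH, h4I, hconv, hpers⟩ :=
    slab_typeI_compactness I v qk Gk hI hswk hwgk hbdk
  -- ## the origin is a backward singular point of the limit
  have hsingw : IsBackwardSingularPoint w 0 := by
    refine hpers fun R hR => ?_
    have e : (fun j => eLpNorm (uncurry (v (σ j))) ⊤
        (volume.restrict (parabolicCylinder R (0 : ℝ × E³)))) = fun _ => ⊤ := by
      funext j
      exact hsingk (σ j) R hR
    rw [e]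
    exact limsup_const ⊤
  -- ## the apex bound passes to the a.e. limit
  have hapex : ∀ᵐ z ∂(volume.restrict (Iio (0 : ℝ) ×ˢ (univ : Set E³))),
      ‖w z.1 z.2‖ ≤ C / (‖z.2‖ + Real.sqrt (-z.1)) := by
    refine ae_restrict_of_ae_restrict_of_subset lowerHalf_subset_iUnion_parabolicCylinder ?_
    rw [ae_restrict_iUnion_iff]
    intro n
    set Q₀ : Set (ℝ × E³) := parabolicCylinder ((n : ℝ) + 1) (0 : ℝ × E³) with hQ₀
    have hQ₀s : Q₀ ⊆ Iio (0 : ℝ) ×ˢ (univ : Set E³) := parabolicCylinder_subset_lowerHalf le_rfl _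
    have hvm : ∀ j, AEStronglyMeasurable (uncurry (v (σ j))) (volume.restrict Q₀) := fun j =>
      (hwgk (σ j)).locallyIntegrableOn.aestronglyMeasurable.mono_measure
        (Measure.restrict_mono hQ₀s le_rfl)
    have hum : AEStronglyMeasurable (uncurry w) (volume.restrict Q₀) :=
      hH.locallyIntegrableOn.aestronglyMeasurable.mono_measure (Measure.restrict_mono hQ₀s le_rfl)
    have hTIM : TendstoInMeasure (volume.restrict Q₀) (fun j => uncurry (v (σ j))) atTop
        (uncurry w) :=
      tendstoInMeasure_of_tendsto_eLpNorm (by norm_num) hvm hum (hconv _ (by positivity))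
    obtain ⟨ns, -, hae⟩ := hTIM.exists_seq_tendsto_ae
    filter_upwards [hae, ae_restrict_mem (isOpen_parabolicCylinder _ _).measurableSet]
      with z hz hzQ
    have hz0 : z.1 < 0 := (hQ₀s hzQ).1
    exact le_of_tendsto' hz.norm fun i => hapexk (σ (ns i)) z hz0
  -- ## conclusion, along the scales `c_j = 2^{-(σ j + 1)}`
  have hIw : typeIBound (Iio (0 : ℝ) ×ˢ univ) w π H < ⊤ :=
    lt_of_le_of_lt h4I (ENNReal.mul_lt_top (by simp) hI)
  have hσge : ∀ j, j ≤ σ j := fun j => hσ.id_le j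
  refine ⟨w, π, H, fun j => lam (σ j), fun j => hlpos _, fun j => hlhalf _, ?_, hsww, hH, hIw,
    fun R hR => hconv R hR, hsingw, hapex⟩
  exact hl0.comp hσ.tendsto_atTop

end Summit.NavierStokesRegularity.NavierStokesRegularity.Theorems.RellichScarNoMildScar

end
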